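import Summits.Schanuel.Schanuel.Theorems.RootDecomp1KGapCell01

/-!
# RootDecomp1KSkelCell — lens 1, generations 43–44 «THE QUALITY-ONLY CLASS SkelLiouville ⊋ LogLogLiouville AND ITS CERTIFIED MEMBER ρ⋆» (PRICE K-α L2033, CLAIM L2045, ACK L2046; (α) PROPER of the 1K wall map): the location-free class `SkelLiouville ρ := ∀ m ∃ r, m ≤ den r ∧ ρ ≠ r ∧ |ρ − r| < den^{−m·ι(den)}` (ι q = least N with q ≤ 2^{N!}) with `LogLogLiouville ⊊ SkelLiouville ⊆ Liouville` PROVED, the member ρ⋆ = Σ_j 2^{−2^{e_j}} (FREDHOLM SERIES WITH DELETED BLOCKS) certified HYPOTHESIS-FREE in Skel ∖ (LogLog ∪ FactorialGap), the SKEL engine + extraction, the walls (1, ℓ₂, ρ) mod hNW / π-twins and the pair (ℓ₂, ρ) HYPOTHESIS-FREE for every ρ ∈ Skel, the items APPLIED at z⋆ with all binders discharged, the m = 1 ceiling, and §9 hNW DISCHARGED BY NAME on the e-wall via the Literature proof module — part 1 (RootDecomp1KSkelCell01): §1 ι and SkelLiouville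

(lens-1 g43/g44 HOME kernel SkelCell.lean EDITION 2 b7163857…, 2822 l, imports tree RootDecomp1KGapCell01 (+ for §9 only Literature ExpOneTranscendenceMeasureProofs); CLAIM L2045, ACK L2046 (CHECKLIST K-α (1)–(8) + the constant-dependence line of L2085 (R4)), NODE L2132 / REQUEST L2133, critic VERDICT L2140 (crit g9: CLEARED — ONE CELL credit (K-α); lens-1 tally credits ×11 + THEOREM; PORT GO in substance 01–0k `--supports stmt-Schanuel-33364`, the two scoped heartbeat raises flagged for the port record, addendum D as RootDecomp1KNWMeasureHolds GO LOW); port by census-1 gen 18 as `RootDecomp1KSkelCell01`–`11` along K's sections: 01 = §1 `iota`, `SkelLiouville`, inclusions `SkelLiouville.liouville` / `logLogLiouville_skelLiouville`; 02 = §5a anchors `aI`/`sI` + §5b the skeleton `eS`, positions `cS`, terms `aS` (up to `summable_aS`); 03 = §5b the member `rhoStar`, truncations `tS`/`rS`, bounds + §6 covering / quality lemmas; 04 = §6 THE MEMBER THEOREMS `skelLiouville_rhoStar`, `not_logLogLiouville_rhoStar`, `not_factorialGapLiouville_rhoStar`, `liouville_rhoStar`, `not_skelLiouville_subset_logLogLiouville`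 + §2 engine preliminaries (`SkelMeasure`, `exists_scale_index_iota`); 05 = §2 THE ENGINE `skelMeasure_cons_liouvilleNumber` (scoped `maxHeartbeats 800000` as in K) + `SkelMeasure.mvWeakMeasure`; 06 = §3 EXTRACTION `no_int_relation_of_skelMeasure_skelLiouville`, `sb_of_skelLiouville_of_skelMeasure`; 07 = §4 THE CELLS (pair hyp-free, walls mod hNW, π-twins) + the live items in item shape; 08 = §7 three interlaced cuts `deletedBlock_margins`, `form_lower_bound_S` (scoped `maxHeartbeats 1600000`); 09 = §7b member tuples zS2/zS3/zS3pi, scope certificates, items AT the members; 10 = §8 the fixed-multiple ladder and the m = 1 ceiling (`uStar`, `skel_fixedOne_ceiling`); 11 = §9 hNW DISCHARGED BY NAME (imports Literature ExpOneTranscendenceMeasureProofs).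
PORT EDITS: `set_option linter.dupNamespace false` dropped; the Literature import moved from the head to part 11 (the only user); K's 13 private helpers travel as per-part private copies; statements and proofs verbatim. `--supports stmt-Schanuel-33364`; no census credit carried; rung 0 — nothing here proves Schanuel.)
-/

/-!
# RootDecomp1KSkelCell — lens 1, generation 44 «SKEL MEMBER ρ⋆ = FREDHOLM SERIES WITH DELETED BLOCKS»
# (RULING L2033 PRICE K-α, CLAIM L2045, CHECKLIST K-α (1)–(8) of L2046; kernel K — 0 sorry, axioms standard;
# EDITION 2: §9 discharges `hNW` BY NAME — the e-wall and the decision of 33364 at `z⋆₃` become HYPOTHESIS-FREE)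

THE OBJECT.  The scale index `ι(q) :=` the least `N` with `q ≤ 2^{N!}` (`Nat.find`) and the QUALITY-ONLY class

  `SkelLiouville ρ := ∀ m, ∃ r : ℚ, m ≤ den r ∧ ρ ≠ r ∧ |ρ − r| < (den r)^{−m·ι(den r)}`

(«order `m·ι(den)` at the scale of the denominator, for every `m`»).  Tree inclusions `LogLog ⊆ Skel ⊆ Liouville`
(§1: `logLogLiouville_skelLiouville`, `SkelLiouville.liouville`; `ι(q) ≤ log log q` for `q > 2^{7!}`) — and the
inclusion `Skel ⊆ LogLog` FAILS (§6), witnessed by THE MEMBER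

  `ρ⋆ := Σ_j 2^{−c_j}`,  `c_j = 2^{e_j}`,  `(e_j)` = the increasing enumeration of `ℕ ∖ ⋃_{i ≥ 4} (a_i, a_i + s_i)`,
  `a_i = ⌊log₂ (2^i)!⌋ + 1`,  `s_i = i + ⌊log₂ i⌋`

— a Fredholm/Kempner-type lacunary binary series `Σ 2^{−2^e}` with the BLOCKS of exponents `(a_i, a_i + s_i)`
DELETED: at the anchor `i` the truncation with denominator `q = 2^{2^{a_i}}` (`ι(q) ≤ 2^i + 1`) approximates `ρ⋆`
to order `2^{s_i} ≈ i·2^i ≳ m·ι(q)` — Skel quality — while `2^{s_i} ≤ 8 a_i ≲ 16 log log q` keeps `ρ⋆` STRICTLY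
BELOW the log-log floor, and the anchors `2^{a_i} ∈ ((2^i)!, 2(2^i)!]` sit ON the factorial skeleton, not in its
gaps (`ρ⋆ ∉ FactorialGap`).  So `ρ⋆` is in NO previously decided class of the route (not LogLog, hence not
LogSq / LogHyper / Hyper by the tree ladder; not FactorialGap), and the cells below are booked on `Skel ⊋ LogLog`.

THE ENGINE (§2, VARIANT-REACH of the tree's induced measure v2, no credit claimed): `MvPolyMeasure θ ⇒
SkelMeasure (ℓ₂, θ)` with `|P(ℓ₂, θ)| ≥ exp(−C(1 + log len P)(1 + ι(len P)))` — the tree proof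
(`LogLogCell.induced_logLog_measure_cons_liouvilleNumber`) re-run KEEPING the integer scale index of the first
admissible factorial scale (`exists_scale_index_iota`: `N₀ ≤ ι(Lz) + e + t + 1`, `N₀! ≤ (N₀+1)(2 log Y + 1)`)
instead of `log log len`.  EXTRACTION (§3): `SkelMeasure θ + SkelLiouville ρ ⇒ (ρ, θ)` algebraically free
(`ι(len H) ≤ ι(q) + 1`, the class parameter `m` absorbs every constant).  CELLS (§4), for EVERY `ρ ∈ Skel`:
the pair `(ℓ₂, ρ)` `SB 2` HYPOTHESIS-FREE (31077 shape), the wall `(1, ℓ₂, ρ)` `SB 3` mod `hNW : NWMeasure` BY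
NAME (§4) and HYPOTHESIS-FREE once `hNW` is discharged by name (§9), the π-twin `(π, πℓ₂, πρ)` `SB 3`
HYPOTHESIS-FREE; item shapes with binders VERBATIM + ONE `Set.range` line.

CONTENTS.  §1 `ι`, `SkelLiouville`, `Nat.find` spec lemmas, `LogLog → Skel → Liouville` · §5a anchors / hole
lengths (`(2^i)! < 2^{a_i} ≤ 2(2^i)!`, `2^i(i+1) ≤ 2·2^{s_i}`, `2^{s_i} ≤ 2^i·i`, `2^{s_i} ≤ 8a_i`, `a_i + s_i < a_{i+1}`) · §5b the kept
exponents `e_j` (`gapAt`, `eS`, `eS_anchor`), `c_j`, `ρ⋆`, truncations `t_N = M_N/2^{c_N}` (odd `M_N`, EXACT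
denominators `rS_den`), tails · §6 the covering lemma `rhoStar_cover` (every rational is a truncation or
`≥ 1/(32 den³)` away) and the MEMBER THEOREMS, all HYPOTHESIS-FREE: (M1) `skelLiouville_rhoStar`, (M2)
`not_logLogLiouville_rhoStar`, (M3) `not_factorialGapLiouville_rhoStar`, (M4) `liouville_rhoStar`;
`not_skelLiouville_subset_logLogLiouville`, `rhoStar_below_previous_classes` · §2 engine `SkelMeasure`,
`skelMeasure_cons_liouvilleNumber`, `SkelMeasure.mvWeakMeasure` · §3 `no_int_relation_of_skelMeasure_skelLiouville`,
`algebraicIndependent_option_of_skelMeasure_skelLiouville`, `sb_of_skelLiouville_of_skelMeasure` · §4 cells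
`sb_skelPair` (HYP-FREE), `sb_skelWall3 (hNW)`, `sb_skelWall3_pi` (HYP-FREE), item shapes
`coordLiouvilleSchanuel_skelPair/skelWall3`, `finiteOrderLiouvilleSchanuel_skelWall3/_pi` · §7 NO HYPER-SMALL
FORMS in `(1, ℓ₂, ρ⋆)`: the margins lemma `deletedBlock_margins` (at an anchor `i ≥ 4`, `M = 2^i`:
`M! ≤ c_j < (M+1)! < c_{j+1} < (M+2)!`, every gap `≥ M!`) and the THREE-CUT form bound `form_lower_bound_S`:
`exp(−(1+Σ|gᵢ|)^85) ≤ |g₀ + g₁ℓ₂ + g₂ρ⋆|` (cuts `(M, j)`, `(M+1, j)`, `(M+1, j+1)`, HYP-FREE) · §7b the members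
`z⋆₂ = (ℓ₂, ρ⋆)`, `z⋆₃ = (1, ℓ₂, ρ⋆)`, `z⋆₃^π`: ℚ-linear independence (from HYP-FREE algebraic independence
`algebraicIndependent_ell2_of_skelLiouville`), `LinLiouville`, 31077 scope, `SB`, and the LIVE ITEMS APPLIED with
every binder discharged by a named lemma: `item33364_at_zS3` / `_at_zS3pi`, `item31077_at_zS2` / `_at_zS3`;
33364 DECIDED at `z⋆₃` (mod `hNW`) and at `z⋆₃^π` (HYP-FREE), 31077 DECIDED at the pair `z⋆₂` (HYP-FREE) · §8 the
fixed-multiple ladder `SkelLiouvilleFix m` (`Skel = ⋂ₘ Skel₍ₘ₎`) and the `m = 1` CEILING (tightness, no credit):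
`u⋆ = 1/(ℓ₂ − 1) ∈ Skel₍₁₎`, `(ℓ₂, u⋆)` ℚ-free with a Liouville coordinate yet algebraically DEPENDENT
(`skel_fixedOne_ceiling`; g42's near-miss `1/ℓ₂` recorded; fixed `m ≥ 2` OPEN). · §9 `hNW` DISCHARGED BY
NAME: `nwMeasure_holds : NWMeasure` IS the Literature theorem `NesterenkoWaldschmidt1996_thm_4_2_holds` (NW96
Thm 4 (2), the measure of `e` — NOT NW96 Thm 1 with its constant 211); hence `sb_skelWall3'`,
`finiteOrderLiouvilleSchanuel_skelWall3'`, `sb_zS3'`, `finiteOrderLiouvilleSchanuel_at_zS3'`, `coordLiouvilleSchanuel_at_zS3'`,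
`sb_logLogWall3_via_skel'` — the e-wall for EVERY Skel (and every log-log) `ρ` and BOTH live items DECIDED at `z⋆₃`,
all HYPOTHESIS-FREE.

Imports the TREE `RootDecomp1KGapCell01` (→ TwoBaseCell09–01 → LogLogCell01 → RelLiouvilleCell08–01 → Hyper chains) and, for §9
only, the LITERATURE proof module `ExpOneTranscendenceMeasureProofs` (sorry-free; NW96 Thm 4 (2) PROVED);
no Theses import (the probe file P reads the live items back BY NAME); tree lemmas used BY NAME except the
attributed `private` re-proofs (`partialSum_two_eq_odd_div'`, `one_le_log_of_sixteen_le'`, `mvPolyMeasure_fin_zero'`,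
`one_div_den_mul_den_le_abs_sub`, the two ℚ-linear-independence helpers of §7b) and the §2/§3 engine/extraction
proofs, which RE-RUN LogLogCell04/02 with `ι` in place of `log log` (attributed in place).  0 sorry · axioms standard.
-/

open Summit.Schanuel.Schanuel.Theorems.RootDecomp1KHyper
open Summit.Schanuel.Schanuel.Theorems.RootDecomp1KHyper.HyperCell
open Summit.Schanuel.Schanuel.Theorems.RootDecomp1KGeneric
open Summit.Schanuel.Schanuel.Theorems.RootDecomp1KRelLiouvilleCell
open Summit.Schanuel.Schanuel.Theorems.RootDecomp1KLogLogCell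
open Summit.Schanuel.Schanuel.Theorems.RootDecomp1KTwoBaseCell
open Summit.Schanuel.Schanuel.Theorems.RootDecomp1KGapCell
open LiouvilleNumber
open scoped Nat

namespace Summit.Schanuel.Schanuel.Theorems.RootDecomp1KSkelCell

/-! ## §1  The scale index `ι` and the quality-only class `SkelLiouville` -/

section SkelClass

/-- Every `q` is below some `2^{N!}` (e.g. `N = q`). -/
theorem exists_le_two_pow_factorial (q : ℕ) : ∃ N : ℕ, q ≤ 2 ^ N ! :=
  ⟨q, (Nat.lt_two_pow_self).le.trans (Nat.pow_le_pow_right two_pos (Nat.self_le_factorial q))⟩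

/-- **The scale index** `ι q :=` the least `N` with `q ≤ 2^{N!}` (`Nat.find`). -/
noncomputable def iota (q : ℕ) : ℕ := Nat.find (exists_le_two_pow_factorial q)

/-- `Nat.find` spec: `q ≤ 2^{(ι q)!}`. -/
theorem iota_spec (q : ℕ) : q ≤ 2 ^ (iota q)! := Nat.find_spec (exists_le_two_pow_factorial q)

/-- `Nat.find` minimality: `q ≤ 2^{N!} → ι q ≤ N`. -/
theorem iota_le_of_le {q N : ℕ} (h : q ≤ 2 ^ N !) : iota q ≤ N := Nat.find_min' _ h

/-- `Nat.find` minimality: `N < ι q → 2^{N!} < q`. -/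
theorem pow_lt_of_lt_iota {q N : ℕ} (h : N < iota q) : 2 ^ N ! < q :=
  not_le.mp (Nat.find_min (exists_le_two_pow_factorial q) h)

/-- `2^{N!} < q → N < ι q`. -/
theorem lt_iota_of_pow_lt {q N : ℕ} (h : 2 ^ N ! < q) : N < iota q := by
  by_contra hc
  have h1 : iota q ≤ N := not_lt.mp hc
  have h2 : q ≤ 2 ^ N ! :=
    (iota_spec q).trans (Nat.pow_le_pow_right two_pos (Nat.factorial_le h1))
  omega

/-- `ι` is monotone. -/
theorem iota_mono {q q' : ℕ} (h : q ≤ q') : iota q ≤ iota q' := iota_le_of_le (h.trans (iota_spec q'))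

/-- `ι q ≤ q`. -/
theorem iota_le_self (q : ℕ) : iota q ≤ q :=
  iota_le_of_le ((Nat.lt_two_pow_self).le.trans (Nat.pow_le_pow_right two_pos (Nat.self_le_factorial q)))

/-- `ι q = 0 ↔ q ≤ 2`. -/
theorem iota_eq_zero_iff {q : ℕ} : iota q = 0 ↔ q ≤ 2 := by
  constructor
  · intro h
    have := iota_spec q
    rw [h] at this
    simpa using this
  · intro h
    exact Nat.le_zero.mp (iota_le_of_le (by simpa using h))

/-- `1 ≤ ι q` for `q ≥ 3`. -/
theorem one_le_iota {q : ℕ} (hq : 3 ≤ q) : 1 ≤ iota q :=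
  lt_iota_of_pow_lt (by rw [Nat.factorial_zero, pow_one]; omega)

/-- **Skel-Liouville reals** (QUALITY ONLY, no location): for every `m` there are rationals `r` with
arbitrarily large denominator `q`, `ρ ≠ r`, and `|ρ − r| < q^{−m·ι(q)}`. -/
def SkelLiouville (ρ : ℝ) : Prop :=
  ∀ m : ℕ, ∃ r : ℚ, m ≤ r.den ∧ ρ ≠ r ∧ |ρ - r| < 1 / (r.den : ℝ) ^ (m * iota r.den)

/-- `SkelLiouville ⇒ Liouville` (Mathlib's `Liouville`): `ι(q) ≥ 1` once `q ≥ 3`. -/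
theorem SkelLiouville.liouville {ρ : ℝ} (hρ : SkelLiouville ρ) : Liouville ρ := by
  intro n
  obtain ⟨r, hden, hne, hlt⟩ := hρ (max n 3)
  have h3 : 3 ≤ r.den := (le_max_right _ _).trans hden
  have hn : n ≤ max n 3 * iota r.den :=
    (le_max_left n 3).trans (Nat.le_mul_of_pos_right _ (one_le_iota h3))
  have hden1 : (1 : ℝ) < r.den := by exact_mod_cast (show 1 < r.den by omega)
  refine ⟨r.num, r.den, by exact_mod_cast (show 1 < r.den by omega), ?_, ?_⟩
  · intro h
    apply hne
    rw [h, Rat.cast_def]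
    push_cast
    rfl
  · have e : ((r.num : ℤ) : ℝ) / (((r.den : ℕ) : ℤ) : ℝ) = (r : ℝ) := by
      rw [Rat.cast_def]; push_cast; rfl
    rw [e]
    have e2 : (1 : ℝ) / (((r.den : ℕ) : ℤ) : ℝ) ^ n = 1 / (r.den : ℝ) ^ n := by push_cast; rfl
    rw [e2]
    refine hlt.trans_le ?_
    exact one_div_le_one_div_of_le (by positivity) (pow_le_pow_right₀ hden1.le hn)

/-- `exp 8 ≤ 5040 · log 2`. -/
private theorem exp_eight_le : Real.exp 8 ≤ (7 ! : ℕ) * Real.log 2 := by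
  have h1 : Real.exp 8 = (Real.exp 1) ^ 8 := by rw [← Real.exp_nat_mul]; norm_num
  have h2 := Real.exp_one_lt_d9
  have h3 := Real.log_two_gt_d9
  have h4 : (Real.exp 1) ^ 8 ≤ (2.7182818286 : ℝ) ^ 8 :=
    pow_le_pow_left₀ (Real.exp_pos 1).le h2.le 8
  have h5 : ((7 ! : ℕ) : ℝ) = 5040 := by norm_num [Nat.factorial]
  rw [h1, h5]
  nlinarith

/-- `exp (N+1) ≤ N! · log 2` for `N ≥ 7`. -/
private theorem exp_le_factorial_mul_log_two {N : ℕ} (hN : 7 ≤ N) :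
    Real.exp ((N : ℝ) + 1) ≤ (N ! : ℕ) * Real.log 2 := by
  induction N, hN using Nat.le_induction with
  | base => norm_num; exact exp_eight_le
  | succ N hN ih =>
    have hlog : 0 < Real.log 2 := Real.log_pos one_lt_two
    have he : Real.exp 1 ≤ (N : ℝ) + 1 := by
      have := Real.exp_one_lt_d9
      have : (8 : ℝ) ≤ (N : ℝ) + 1 := by exact_mod_cast Nat.succ_le_succ hN
      linarith
    have e1 : Real.exp (((N + 1 : ℕ) : ℝ) + 1) = Real.exp ((N : ℝ) + 1) * Real.exp 1 := by
      rw [← Real.exp_add]; push_cast; ring_nf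
    rw [e1, Nat.factorial_succ]; push_cast
    have h0 : (0 : ℝ) ≤ ((N ! : ℕ) : ℝ) * Real.log 2 := by positivity
    calc Real.exp ((N : ℝ) + 1) * Real.exp 1 ≤ (((N ! : ℕ) : ℝ) * Real.log 2) * ((N : ℝ) + 1) :=
          mul_le_mul ih he (Real.exp_pos 1).le h0
      _ = ((N : ℝ) + 1) * ((N ! : ℕ) : ℝ) * Real.log 2 := by ring

/-- `ι q ≤ log log q` once `q > 2^{7!}`. -/
theorem iota_le_loglog {q : ℕ} (hq : 2 ^ 7 ! < q) : (iota q : ℝ) ≤ Real.log (Real.log q) := by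
  have h8 : 7 < iota q := lt_iota_of_pow_lt hq
  obtain ⟨N, hN⟩ : ∃ N, iota q = N + 1 := ⟨iota q - 1, by omega⟩
  have hlt : 2 ^ N ! < q := pow_lt_of_lt_iota (by omega)
  have hN7 : 7 ≤ N := by omega
  have key := exp_le_factorial_mul_log_two hN7
  have hq0 : (0 : ℝ) < q := by exact_mod_cast (Nat.zero_le _).trans_lt hq
  have h1 : ((N ! : ℕ) : ℝ) * Real.log 2 < Real.log q := by
    have h := Real.log_lt_log (by positivity) (show ((2 : ℝ) ^ N !) < q by exact_mod_cast hlt)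
    rwa [Real.log_pow] at h
  have h2 : Real.exp ((N : ℝ) + 1) < Real.log q := key.trans_lt h1
  have hlogq : 0 < Real.log q := (Real.exp_pos _).trans h2
  have h3 : (N : ℝ) + 1 < Real.log (Real.log q) := by
    rw [Real.lt_log_iff_exp_lt hlogq]; exact h2
  rw [hN]; push_cast; linarith

/-- `LogLogLiouville ⇒ SkelLiouville` (`exp(−m log q loglog q) ≤ q^{−m ι(q)}` as `ι q ≤ loglog q` for
`q > 2^{7!}`; the threshold is fed into the class parameter). -/
theorem logLogLiouville_skelLiouville {ρ : ℝ} (hρ : LogLogLiouville ρ) : SkelLiouville ρ := by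
  intro m
  -- the threshold `T = 2^{7!}` is kept symbolic (no numeral evaluation)
  obtain ⟨T, hT⟩ : ∃ T : ℕ, T = 2 ^ 7 ! := ⟨_, rfl⟩
  obtain ⟨r, hden, hne, hlt⟩ := hρ (max m (T + 1))
  refine ⟨r, (le_max_left _ _).trans hden, hne, hlt.trans_le ?_⟩
  have hq' : T < r.den := Nat.lt_of_succ_le ((le_max_right _ _).trans hden)
  have hq : 2 ^ 7 ! < r.den := hT ▸ hq'
  have hqpos : (0 : ℝ) < r.den := by exact_mod_cast r.den_pos
  have hι := iota_le_loglog hq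
  have hι0 : (0 : ℝ) ≤ iota r.den := Nat.cast_nonneg _
  have hmM : (m : ℝ) ≤ ((max m (T + 1) : ℕ) : ℝ) := by exact_mod_cast le_max_left _ _
  have hlogq : 0 ≤ Real.log r.den := Real.log_nonneg (by exact_mod_cast r.den_pos)
  have e : (1 : ℝ) / (r.den : ℝ) ^ (m * iota r.den) =
      Real.exp (-(((m * iota r.den : ℕ) : ℝ) * Real.log r.den)) := by
    rw [Real.exp_neg, Real.exp_nat_mul, Real.exp_log hqpos, one_div]
  rw [e, Real.exp_le_exp, neg_le_neg_iff, Nat.cast_mul]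
  have h1 : (m : ℝ) * (iota r.den : ℝ) ≤ ((max m (T + 1) : ℕ) : ℝ) * Real.log (Real.log r.den) :=
    mul_le_mul hmM hι hι0 (Nat.cast_nonneg _)
  calc (m : ℝ) * (iota r.den) * Real.log r.den
      = ((m : ℝ) * (iota r.den)) * Real.log r.den := by ring
    _ ≤ (((max m (T + 1) : ℕ) : ℝ) * Real.log (Real.log r.den)) * Real.log r.den :=
        mul_le_mul_of_nonneg_right h1 hlogq
    _ = ((max m (T + 1) : ℕ) : ℝ) * Real.log r.den * Real.log (Real.log r.den) := by ring

end SkelClass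

end Summit.Schanuel.Schanuel.Theorems.RootDecomp1KSkelCell
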